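import Summits.QuantumFields.YangMills.Theorems.AllWindowsColdBoxBoxHighLineWilsonPlaquetteTaylor
import Summits.QuantumFields.YangMills.Theorems.AllWindowsColdBoxBoxHighLineQuarticL2

/-!
# T-S5.12c `quarticL2 : QuarticL2` BY NAME (unconditional) — ✓`quarticL2_of (h7a : WilsonPlaquetteTaylor)` discharged by ✓T-S5.7a `wilsonPlaquetteTaylor`
# (STUB-PLAN-S5-STEP2 §8, ✓`…Step2Wick`; LINE-19 S5 ⟨stmt-QuantumFields-24004⟩/⟨24335⟩)

Seat `ym-line-fcl-p3` (g26, cell ym-idea-1): the one-line closure the planner asked for (ym-idea-2 g18, 2026-08-29T20:15:08Z (3)).  The `L²(Gaussian)` sizes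
of the even non-Gaussian parts of the action — `E₀[quarticWilson²] ≤ C H⁸/β²` and `E₀[(β(Φ(U(a)) − divLinSq))²] ≤ C H⁸/β²` for `β ≥ H⁴`, `H ≥ 1` — now hold
unconditionally: the only hypothesis of ✓`quarticL2_of` was the quartic plaquette expansion T-S5.7a (w2's lineage), a tree theorem since ✓`…WilsonPlaquetteTaylor`;
the Φ-half ✓`quarticL2_phi` never depended on it.

HONEST LABEL: a support brick of STEP 2 of the XL stub S5 (`stub_landauSecondOrder`) of a critic-PASSed DRAFT line; S5, U5, ⟨24004⟩ ⟨24335⟩ ⟨24336⟩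
remain OPEN; no stub is closed by name, no crux, rung or summit is proved; **the Yang–Mills mass gap is NOT proved by this file.**
-/

set_option autoImplicit false

namespace Summit.QuantumFields.YangMills.Theorems.AllWindowsColdBoxBoxHighLine

/-- **T-S5.12c `QuarticL2`, BY NAME, unconditional** (✓`quarticL2_of` + ✓`wilsonPlaquetteTaylor`). -/
theorem quarticL2 : QuarticL2 := quarticL2_of wilsonPlaquetteTaylor

end Summit.QuantumFields.YangMills.Theorems.AllWindowsColdBoxBoxHighLine
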